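import Summits.AtomisticToContinuum.HydrodynamicLimit.Theorems.CollisionIsometryCLTCollisionalTransferLocalityFluxForm
import HarnessLib

/-!
# Audit lemmas for stub [A'-chaos]° `stub_fluxFormChaosE`, part 2: domination of the collision side
(line hemisphere-affine-slaving, crux `CollisionalTransferLocality`, stmt-AtomisticToContinuum-9518, v8)

Sorry-free bookkeeping facts found during the adversarial audit of the RE-KEYED research stub
`stub_fluxFormChaosE` (stub worker W-A of the lead prover-line-stmt-AtomisticToContinuum-9518-c4-0, census
`work/stubs/stub_fluxFormChaosE.census.md`; part 1 is `…FluxFormChaosEAudit`, linearity in the tests):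

* DOMINATION OF THE COLLISION SIDE. `|markK| ≤ 6 C₁ · virialK` for slices with gradients bounded by `C₁`
  (`abs_markK_le`), hence `|M_N(z, τ)| ≤ 6 C₁ V_N(z, τ)` on the good set (`abs_Mfun_le`) and `M_N` is tight
  uniformly in `τ ≤ t` under [V] `VirialBounded` (`Mfun_tight_of_virialBounded`, registered helper); with the
  stub, `Sraw_N` is then tight too (`Sraw_tight_of_fluxFormChaos`) — the chaos side `Sraw_N` (marks
  `affW ∋ ū·∇χ, q·∇χ/ρ̄θ̄`) is NOT dominated by `virialK` on its own (census §1(c)): that gap is inside the stub.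
* DEGENERATE KEYING. A negative energy cap `E₀ < 0` makes the energy hypothesis say `P_N(univ) → 0`, under
  which `FluxFormChaos` holds for every kernel and test (`fluxFormChaos_of_energyCap_of_neg`, the analogue of
  W-B's `contactVirial_of_energyCap_of_neg`).
-/

namespace Summit.AtomisticToContinuum.HydrodynamicLimit.Theorems.HemisphereAffineSlaving

open scoped BigOperators Topology Classical ENNReal InnerProductSpace
open Filter Set Function MeasureTheory
open Literature.Analysis.FunctionSpaces Literature.Analysis.FluidPDE

noncomputable section

open Literature.MathematicalPhysics.KineticTheory (T3 V3 hsDiameter hsDiameter_pos localGibbsLaw tendsto_hsDiameter)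

/-! ## 1. Domination of the collision side `M_N` by the weighted collision virial -/

section Domination

/-- The unit normal has norm at most `1` (it is `0` at the junk `n = 0`). [folklore] -/
theorem norm_omg_le_one (N : ℕ) (w : Cfg N) (i j : Fin (N + 1)) : ‖omg N w i j‖ ≤ 1 := by
  by_cases hn : sepV N w i j = 0
  · have : omg N w i j = 0 := by simp [omg, hn]
    rw [this, norm_zero]; exact zero_le_one
  · exact (norm_omg hn).le

/-- Coordinates of the unit normal are at most `1` in absolute value. [folklore] -/
theorem abs_omg_apply_le_one (N : ℕ) (w : Cfg N) (i j : Fin (N + 1)) (a : Fin 3) : |omg N w i j a| ≤ 1 := by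
  have h : ‖omg N w i j a‖ ≤ ‖omg N w i j‖ := PiLp.norm_apply_le (omg N w i j) a
  rw [Real.norm_eq_abs] at h
  exact h.trans (norm_omg_le_one N w i j)

/-- **`|markK| ≤ 6 C₁ · virialK`.** If the gradients of the slices `ψ s`, `χ s` at `x_i` are bounded by `C₁`
(componentwise), the flux-form mark of the ordered pair is at most `6 C₁` times its weighted virial kernel
`ε_N ‖Δv_i‖ (1 + ‖v_i‖ + ‖v_j‖)` (`|ω_a| ≤ 1`, `|⟪V, ω⟫| ≤ (‖v_i‖ + ‖v_j‖)/2`). [folklore] -/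
theorem abs_markK_le {σ : ℝ} (hσ : 0 ≤ σ) {N : ℕ} (w : Cfg N) (i j : Fin (N + 1)) {ψ : ℝ → T3 → V3}
    {χ : ℝ → T3 → ℝ} {s C₁ : ℝ} (hCψ : ∀ a b, |gradPsi ψ s (w i).1 a b| ≤ C₁)
    (hCχ : ∀ a, |gradChi χ s (w i).1 a| ≤ C₁) :
    |markK σ ψ χ N s w i j| ≤ 6 * C₁ * virialK σ N s w i j := by
  have hC0 : 0 ≤ C₁ := (abs_nonneg _).trans (hCχ 0)
  have hε : 0 ≤ hsDiameter σ N := by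
    unfold Literature.MathematicalPhysics.KineticTheory.hsDiameter; positivity
  have hω := abs_omg_apply_le_one N w i j
  -- the `ω⊗ω : ∇ψ` mark
  have hA : |∑ a, ∑ b, omg N w i j a * omg N w i j b * gradPsi ψ s (w i).1 a b| ≤ 9 * C₁ := by
    calc _ ≤ ∑ a, |∑ b, omg N w i j a * omg N w i j b * gradPsi ψ s (w i).1 a b| := Finset.abs_sum_le_sum_abs _ _
      _ ≤ ∑ a, ∑ b, |omg N w i j a * omg N w i j b * gradPsi ψ s (w i).1 a b| :=
          Finset.sum_le_sum fun a _ => Finset.abs_sum_le_sum_abs _ _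
      _ ≤ ∑ _a : Fin 3, ∑ _b : Fin 3, C₁ := Finset.sum_le_sum fun a _ => Finset.sum_le_sum fun b _ => by
          rw [abs_mul, abs_mul]
          calc |omg N w i j a| * |omg N w i j b| * |gradPsi ψ s (w i).1 a b| ≤ 1 * 1 * C₁ :=
                mul_le_mul (mul_le_mul (hω a) (hω b) (abs_nonneg _) zero_le_one) (hCψ a b) (abs_nonneg _)
                  (by norm_num)
            _ = C₁ := by ring
      _ = 9 * C₁ := by simp; ring
  -- the `(V·ω) ω·∇χ` mark
  have hB : |∑ a, omg N w i j a * gradChi χ s (w i).1 a| ≤ 3 * C₁ := by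
    calc _ ≤ ∑ a, |omg N w i j a * gradChi χ s (w i).1 a| := Finset.abs_sum_le_sum_abs _ _
      _ ≤ ∑ _a : Fin 3, C₁ := Finset.sum_le_sum fun a _ => by
          rw [abs_mul]
          calc |omg N w i j a| * |gradChi χ s (w i).1 a| ≤ 1 * C₁ :=
                mul_le_mul (hω a) (hCχ a) (abs_nonneg _) zero_le_one
            _ = C₁ := one_mul _
      _ = 3 * C₁ := by simp
  have hV : |⟪Vcm N w i j, omg N w i j⟫_ℝ| ≤ (‖(w i).2‖ + ‖(w j).2‖) / 2 := by
    calc |⟪Vcm N w i j, omg N w i j⟫_ℝ| ≤ ‖Vcm N w i j‖ * ‖omg N w i j‖ := abs_real_inner_le_norm _ _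
      _ ≤ ‖Vcm N w i j‖ * 1 := mul_le_mul_of_nonneg_left (norm_omg_le_one N w i j) (norm_nonneg _)
      _ ≤ (‖(w i).2‖ + ‖(w j).2‖) / 2 := by
          rw [mul_one, Vcm, norm_smul, Real.norm_eq_abs, abs_of_pos (by norm_num : (0 : ℝ) < 1 / 2)]
          have := norm_add_le (w i).2 (w j).2
          linarith
  have hmark : |(∑ a, ∑ b, omg N w i j a * omg N w i j b * gradPsi ψ s (w i).1 a b) +
      ⟪Vcm N w i j, omg N w i j⟫_ℝ * ∑ a, omg N w i j a * gradChi χ s (w i).1 a| ≤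
      9 * C₁ + (‖(w i).2‖ + ‖(w j).2‖) / 2 * (3 * C₁) := by
    refine (abs_add_le _ _).trans (add_le_add hA ?_)
    rw [abs_mul]
    exact mul_le_mul hV hB (abs_nonneg _) (by positivity)
  rw [markK, abs_mul, abs_mul, abs_of_nonneg (by positivity : (0 : ℝ) ≤ hsDiameter σ N / 2), abs_norm, virialK]
  have hdv := norm_nonneg (dV N w i j)
  have hvi := norm_nonneg (w i).2
  have hvj := norm_nonneg (w j).2
  calc hsDiameter σ N / 2 * ‖dV N w i j‖ * |(∑ a, ∑ b, omg N w i j a * omg N w i j b * gradPsi ψ s (w i).1 a b) +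
        ⟪Vcm N w i j, omg N w i j⟫_ℝ * ∑ a, omg N w i j a * gradChi χ s (w i).1 a|
      ≤ hsDiameter σ N / 2 * ‖dV N w i j‖ * (9 * C₁ + (‖(w i).2‖ + ‖(w j).2‖) / 2 * (3 * C₁)) :=
        mul_le_mul_of_nonneg_left hmark (by positivity)
    _ ≤ 6 * C₁ * (hsDiameter σ N * ‖dV N w i j‖ * (1 + ‖(w i).2‖ + ‖(w j).2‖)) := by
        nlinarith [mul_nonneg (mul_nonneg hε hdv) hC0, mul_nonneg (mul_nonneg (mul_nonneg hε hdv) hC0) (add_nonneg hvi hvj)]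

/-- **`|M_N(z, τ)| ≤ 6 C₁ · V_N(z, τ)` on the good set** for tests whose slice gradients on `[0, t]` are bounded
by `C₁` and `τ ≤ t` (`σ ≥ 0`). [folklore] -/
theorem abs_Mfun_le {σ : ℝ} (hσ : 0 ≤ σ) (Φ : Flows σ) {N : ℕ} {z : Cfg N} (hz : z ∈ (Φ N).good) {t : ℝ}
    {ψ : ℝ → T3 → V3} {χ : ℝ → T3 → ℝ} {C₁ : ℝ} (hCψ : ∀ s ∈ Icc 0 t, ∀ x a b, |gradPsi ψ s x a b| ≤ C₁)
    (hCχ : ∀ s ∈ Icc 0 t, ∀ x a, |gradChi χ s x a| ≤ C₁) {τ : ℝ} (hτ : τ ≤ t) :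
    |Mfun σ Φ ψ χ N z τ| ≤ 6 * C₁ * virialW σ Φ N z τ := by
  have hfin := ((Φ N).isTrajectory z hz).finite_collisionTimes_inter_Ioc 0 τ
  have hc0 : (0 : ℝ) ≤ ((N : ℝ) + 1)⁻¹ := by positivity
  unfold Mfun virialW HardSphereFlow.collisionPairSum
  rw [collisionPairSum_eq_finset_sum hfin, collisionPairSum_eq_finset_sum hfin, abs_mul, abs_of_nonneg hc0,
    mul_left_comm, Finset.mul_sum]
  refine mul_le_mul_of_nonneg_left ((Finset.abs_sum_le_sum_abs _ _).trans
    (Finset.sum_le_sum fun tc htc => ?_)) hc0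
  have hs : tc ∈ Icc 0 t := by
    have h := ((Set.Finite.mem_toFinset hfin).1 htc).2
    exact ⟨h.1.le, h.2.trans hτ⟩
  rw [Finset.mul_sum]
  refine (Finset.abs_sum_le_sum_abs _ _).trans (Finset.sum_le_sum fun p _ => ?_)
  exact abs_markK_le hσ _ p.1 p.2 (hCψ tc hs _) (hCχ tc hs _)

variable {σ : ℝ} {a₀ θ₀ : T3 → ℝ} {u₀ : T3 → V3} {Φ : Flows σ} {t : ℝ} {ψ : ℝ → T3 → V3} {χ : ℝ → T3 → ℝ}

/-- **`M_N` is tight, uniformly in `τ ≤ t`, under [V].** For `σ > 0`, jointly smooth tests on `[0, t]` and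
`VirialBounded σ a₀ θ₀ u₀ Φ t`: for every `δ > 0` some level `K` bounds `sup_{τ ≤ t} |M_N(z, τ)|` off an event of
probability `≤ δ` for all large `N` (`|M_N(τ)| ≤ 6 C₁ V_N(τ) ≤ 6 C₁ V_N(t)` on the good set). The collision side
of [A'-chaos] is dominated by the a-priori input; the chaos side `Sraw_N` is not (its marks carry the block
fields `ū`, `q/ρ̄θ̄`), cf. `Sraw_tight_of_fluxFormChaos`. [folklore] -/
theorem Mfun_tight_of_virialBounded' (hσ : 0 < σ) (ht : 0 < t) (hψ : Torus.IsSmoothSpaceTimeOn (Icc 0 t) ψ)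
    (hχ : Torus.IsSmoothSpaceTimeOn (Icc 0 t) χ) (hV : VirialBounded σ a₀ θ₀ u₀ Φ t) :
    ∀ δ : ℝ, 0 < δ → ∃ K : ℝ, ∀ᶠ N : ℕ in atTop,
      localGibbsLaw σ a₀ u₀ θ₀ N (Φ N) {z | ∃ τ ∈ Icc 0 t, K < |Mfun σ Φ ψ χ N z τ|} ≤ ENNReal.ofReal δ := by
  intro δ hδ
  obtain ⟨C₁, hC₁, hCψ, hCχ⟩ := exists_grad_bound ht hψ hχ
  obtain ⟨K, hK⟩ := hV δ hδ
  refine ⟨6 * C₁ * max K 0, hK.mono fun N hN => ?_⟩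
  have hcover : {z : Cfg N | ∃ τ ∈ Icc 0 t, 6 * C₁ * max K 0 < |Mfun σ Φ ψ χ N z τ|} ⊆
      (Φ N).goodᶜ ∪ {z | K < virialW σ Φ N z t} := by
    rintro z ⟨τ, hτ, hzK⟩
    by_cases hz : z ∈ (Φ N).good
    · right
      by_contra hle
      simp only [Set.mem_setOf_eq, not_lt] at hle
      have h1 := abs_Mfun_le hσ.le Φ hz hCψ hCχ hτ.2
      have h2 : virialW σ Φ N z τ ≤ virialW σ Φ N z t := virialW_mono hσ Φ hz hτ.2
      have h3 : virialW σ Φ N z t ≤ max K 0 := hle.trans (le_max_left _ _)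
      have h4 : 6 * C₁ * virialW σ Φ N z τ ≤ 6 * C₁ * max K 0 :=
        mul_le_mul_of_nonneg_left (h2.trans h3) (by positivity)
      linarith
    · exact Or.inl hz
  calc localGibbsLaw σ a₀ u₀ θ₀ N (Φ N) {z : Cfg N | ∃ τ ∈ Icc 0 t, 6 * C₁ * max K 0 < |Mfun σ Φ ψ χ N z τ|}
      ≤ localGibbsLaw σ a₀ u₀ θ₀ N (Φ N) ((Φ N).goodᶜ ∪ {z | K < virialW σ Φ N z t}) := measure_mono hcover
    _ ≤ localGibbsLaw σ a₀ u₀ θ₀ N (Φ N) (Φ N).goodᶜ + localGibbsLaw σ a₀ u₀ θ₀ N (Φ N) {z | K < virialW σ Φ N z t} :=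
        measure_union_le _ _
    _ ≤ ENNReal.ofReal δ := by rw [localGibbsLaw_compl_good' (Φ N), zero_add]; exact hN

/-- **Registered helper `Mfun_tight_of_virialBounded` — `M_N` is tight, uniformly in `τ ≤ t`, under [V]**
(audit helper for `stub_fluxFormChaosE`, worker W-A of lead c4): for `σ > 0`, jointly smooth tests on `[0, t]` and
`VirialBounded σ a₀ θ₀ u₀ Φ t`, every `δ > 0` has a level `K` with `P_N(sup_{τ ≤ t} |M_N(τ)| > K) ≤ δ` for all large
`N` — the collision side of [A'-chaos] is dominated by the a-priori input [V] (`|M_N(τ)| ≤ 6 C₁ V_N(τ) ≤ 6 C₁ V_N(t)` on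
the good set). [folklore] -/
theorem Mfun_tight_of_virialBounded : ∀ {σ : ℝ} {a₀ θ₀ : T3 → ℝ} {u₀ : T3 → V3} {Φ : Flows σ} {t : ℝ} {ψ : ℝ → T3 → V3} {χ : ℝ → T3 → ℝ}, 0 < σ → 0 < t → Literature.Analysis.FunctionSpaces.Torus.IsSmoothSpaceTimeOn (Icc 0 t) ψ → Literature.Analysis.FunctionSpaces.Torus.IsSmoothSpaceTimeOn (Icc 0 t) χ → VirialBounded σ a₀ θ₀ u₀ Φ t → ∀ δ : ℝ, 0 < δ → ∃ K : ℝ, ∀ᶠ N : ℕ in atTop, Literature.MathematicalPhysics.KineticTheory.localGibbsLaw σ a₀ u₀ θ₀ N (Φ N) {z | ∃ τ ∈ Icc 0 t, K < |Mfun σ Φ ψ χ N z τ|} ≤ ENNReal.ofReal δ :=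
  fun hσ ht hψ hχ hV => Mfun_tight_of_virialBounded' hσ ht hψ hχ hV

/-- **With the stub, the chaos side is tight too**: `FluxFormChaos` and [V] make `sup_{τ ≤ t} |Sraw_N(z, τ)|`
tight (`|Sraw| ≤ |M| + |M − Sraw|`). This is the form in which [A'-chaos] feeds the tightness of the slaved sum
`S_N = Sraw_N` (lever) that [B-dyn] needs. [folklore] -/
theorem Sraw_tight_of_fluxFormChaos (hσ : 0 < σ) (ht : 0 < t) (hψ : Torus.IsSmoothSpaceTimeOn (Icc 0 t) ψ)
    (hχ : Torus.IsSmoothSpaceTimeOn (Icc 0 t) χ) (hV : VirialBounded σ a₀ θ₀ u₀ Φ t) {φ : ℕ → T3 → ℝ}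
    (hCh : FluxFormChaos σ a₀ θ₀ u₀ Φ φ t ψ χ) :
    ∀ δ : ℝ, 0 < δ → ∃ K : ℝ, ∀ᶠ N : ℕ in atTop,
      localGibbsLaw σ a₀ u₀ θ₀ N (Φ N) {z | ∃ τ ∈ Icc 0 t, K < |Sraw σ Φ φ ψ χ N z τ|} ≤ ENNReal.ofReal δ := by
  intro δ hδ
  have hδ2 : 0 < δ / 2 := half_pos hδ
  obtain ⟨K, hK⟩ := Mfun_tight_of_virialBounded' hσ ht hψ hχ hV (δ / 2) hδ2
  have hA : ∀ᶠ N : ℕ in atTop, localGibbsLaw σ a₀ u₀ θ₀ N (Φ N)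
      {z | ∃ τ ∈ Icc 0 t, 1 < |Mfun σ Φ ψ χ N z τ - Sraw σ Φ φ ψ χ N z τ|} ≤ ENNReal.ofReal (δ / 2) :=
    ((tendsto_order.1 (hCh 1 one_pos)).2 _ (ENNReal.ofReal_pos.2 hδ2)).mono fun N hN => hN.le
  refine ⟨K + 1, ?_⟩
  filter_upwards [hK, hA] with N hN1 hN2
  have hcover : {z : Cfg N | ∃ τ ∈ Icc 0 t, K + 1 < |Sraw σ Φ φ ψ χ N z τ|} ⊆
      {z | ∃ τ ∈ Icc 0 t, K < |Mfun σ Φ ψ χ N z τ|} ∪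
        {z | ∃ τ ∈ Icc 0 t, 1 < |Mfun σ Φ ψ χ N z τ - Sraw σ Φ φ ψ χ N z τ|} := by
    rintro z ⟨τ, hτ, hzK⟩
    by_contra hno
    simp only [Set.mem_union, Set.mem_setOf_eq, not_or, not_exists, not_and, not_lt] at hno
    have e₁ := hno.1 τ hτ
    have e₂ := hno.2 τ hτ
    have htri := abs_sub_le (Sraw σ Φ φ ψ χ N z τ) (Mfun σ Φ ψ χ N z τ) 0
    rw [sub_zero, sub_zero, abs_sub_comm] at htri
    linarith
  calc localGibbsLaw σ a₀ u₀ θ₀ N (Φ N) {z : Cfg N | ∃ τ ∈ Icc 0 t, K + 1 < |Sraw σ Φ φ ψ χ N z τ|}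
      ≤ localGibbsLaw σ a₀ u₀ θ₀ N (Φ N) ({z | ∃ τ ∈ Icc 0 t, K < |Mfun σ Φ ψ χ N z τ|} ∪
          {z | ∃ τ ∈ Icc 0 t, 1 < |Mfun σ Φ ψ χ N z τ - Sraw σ Φ φ ψ χ N z τ|}) := measure_mono hcover
    _ ≤ _ := measure_union_le _ _
    _ ≤ ENNReal.ofReal (δ / 2) + ENNReal.ofReal (δ / 2) := add_le_add hN1 hN2
    _ = ENNReal.ofReal δ := by rw [← ENNReal.ofReal_add hδ2.le hδ2.le, add_halves]

end Domination

/-! ## 2. A negative energy cap degenerates the laws (harmless) -/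

/-- **Negative energy cap.** If `E₀ < 0` and `0 ≤ t`, the energy event of the v8 keying is everything
(`(N+1)⁻¹ E(Φ_0 z) ≥ 0 > E₀`), so its hypothesis says `P_N(univ) → 0`, and then `FluxFormChaos` holds for
EVERY kernel family and test pair (verbatim the mechanism of `contactVirial_of_energyCap_of_neg`). [folklore] -/
theorem fluxFormChaos_of_energyCap_of_neg {σ : ℝ} {a₀ θ₀ : T3 → ℝ} {u₀ : T3 → V3} {Φ : Flows σ}
    {t E₀ : ℝ} (ht : 0 ≤ t) (hE : E₀ < 0)
    (hcap : Tendsto (fun N : ℕ => localGibbsLaw σ a₀ u₀ θ₀ N (Φ N)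
      {z | ∃ s ∈ Icc 0 t, E₀ < ((N : ℝ) + 1)⁻¹ * configEnergy ((Φ N).flow s z)}) atTop (𝓝 0))
    (φ : ℕ → T3 → ℝ) (ψ : ℝ → T3 → V3) (χ : ℝ → T3 → ℝ) :
    FluxFormChaos σ a₀ θ₀ u₀ Φ φ t ψ χ := by
  intro δ _hδ
  refine tendsto_of_tendsto_of_tendsto_of_le_of_le tendsto_const_nhds hcap (fun N => bot_le)
    fun N => measure_mono fun z _ => ?_
  refine ⟨0, ⟨le_rfl, ht⟩, hE.trans_le ?_⟩
  refine mul_nonneg (inv_nonneg.2 (by positivity)) ?_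
  unfold configEnergy
  positivity

end

end Summit.AtomisticToContinuum.HydrodynamicLimit.Theorems.HemisphereAffineSlaving
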